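import Summits.AtomisticToContinuum.FouriersLaw.Theses.FourierGreenKubo
import Summits.AtomisticToContinuum.FouriersLaw.Theses.FeketeResistance
import Summits.AtomisticToContinuum.FouriersLaw.Theses.SuperadditiveJunction
import Summits.AtomisticToContinuum.FouriersLaw.Theorems.OddSectorIrreversibilityCorrectorTheoryUniformMixing

/-!
# The finite-`N` response coefficient exists (stmt-AtomisticToContinuum-0717 `fourier_finite_response_of_unique`)

For the pinned anharmonic chain, under weak-NESS uniqueness, for every steady-state family, every `T > 0`
and every `N`, the linear-response limit `D_N = lim_{δ→0, δ≠0} totalCurrent(μ_{N,T+δ/2,T-δ/2})/δ` EXISTS.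
This is a corollary of the Kundu–Dhar–Narayan open-chain Green–Kubo identity proved in
`OddSectorIrreversibilityCorrectorTheoryUniformMixing.lean` (`Corrector.openChainGreenKubo_holds`), which
for `N ≥ 2` asserts the convergence of the response quotient (to `∫₀^∞ corr(J,J)/((N-1)T²)`); for `N ≤ 1`
there are no bonds, the total current vanishes identically and `D_N = 0`.

* `finiteResponse_of_unique` — the item's signature;
* `finiteResponseOfUnique_holds`, `fourierFiniteResponseOfUnique_holds`, `feketeFiniteResponseOfUnique_holds`,
  `superadditiveFiniteResponseOfUnique_holds` — the (verbatim identical) route decls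
  `OddSectorIrreversibility.FiniteResponseOfUnique`, `FourierGreenKubo.FourierFiniteResponseOfUnique`,
  `FeketeResistance.FiniteResponseOfUnique`, `SuperadditiveJunction.FiniteResponseOfUnique`.

No definitions, no named facts.
-/

noncomputable section

open MeasureTheory Filter Topology Set

namespace Summit.AtomisticToContinuum.FouriersLaw.Theorems.FourierGreenKubo

open Literature.MathematicalPhysics.KineticTheory.HeatConduction

/-- **The finite-`N` response coefficient exists** (item stmt-AtomisticToContinuum-0717): under weak-NESS
uniqueness, for every steady-state family `μ`, `T > 0` and `N`, the quotient
`totalCurrent(μ N (T+δ/2) (T-δ/2))/δ` converges as `δ → 0`, `δ ≠ 0`. For `N ≥ 2` this is the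
convergence clause of the open-chain Green–Kubo identity (`Corrector.openChainGreenKubo_holds`); for
`N ≤ 1` all bond currents vanish and the limit is `0`. [cite: KunduDharNarayan2009, p. 3]
[cite: CuneoEckmannHairerReyBellet2018, Thm 2.13] -/
theorem finiteResponse_of_unique :
    ∀ ω₂ lam β γ : ℝ, 0 < ω₂ → 0 < lam → 0 < β → 0 < γ → (∀ (N : ℕ) (T_L T_R : ℝ), 0 < T_L → 0 < T_R → ∀ μ ν : MeasureTheory.Measure (Literature.MathematicalPhysics.KineticTheory.HeatConduction.PhaseSpace N), (Literature.MathematicalPhysics.KineticTheory.HeatConduction.pinnedChain ω₂ lam β γ).IsSteadyState N T_L T_R μ → (Literature.MathematicalPhysics.KineticTheory.HeatConduction.pinnedChain ω₂ lam β γ).IsSteadyState N T_L T_R ν → μ = ν) → ∀ μ : (N : ℕ) → ℝ → ℝ → MeasureTheory.Measure (Literature.MathematicalPhysics.KineticTheory.HeatConduction.PhaseSpace N), (∀ (N : ℕ) (T_L T_R : ℝ), 0 < T_L → 0 < T_R → (Literature.MathematicalPhysics.KineticTheory.HeatConduction.pinnedChain ω₂ lam β γ).IsSteadyState N T_L T_R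 (μ N T_L T_R)) → ∀ T : ℝ, 0 < T → ∀ N : ℕ, ∃ D : ℝ, Filter.Tendsto (fun δ : ℝ => (Literature.MathematicalPhysics.KineticTheory.HeatConduction.pinnedChain ω₂ lam β γ).totalCurrent (μ N (T + δ / 2) (T - δ / 2)) / δ) (nhdsWithin 0 {(0 : ℝ)}ᶜ) (nhds D) := by
  intro ω₂ lam β γ hω hl hβ hγ hU μ hμ T hT N
  rcases lt_or_ge N 2 with hN | hN
  · -- `N ≤ 1`: no bonds, no current
    refine ⟨0, ?_⟩
    have hj : ∀ (i : Fin N) (x : PhaseSpace N), (pinnedChain ω₂ lam β γ).bondCurrent N i x = 0 := fun i x => by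
      unfold OscillatorChain.bondCurrent
      refine Finset.sum_eq_zero fun j _ => ?_
      have hji : ¬ (j.val = i.val + 1) := by have := j.isLt; omega
      rw [if_neg hji]
    have e : (fun δ : ℝ => (pinnedChain ω₂ lam β γ).totalCurrent (μ N (T + δ / 2) (T - δ / 2)) / δ) = fun _ => 0 :=
      funext fun δ => by
        have : (pinnedChain ω₂ lam β γ).totalCurrent (μ N (T + δ / 2) (T - δ / 2)) = 0 := by
          show ∑ i : Fin N, ∫ x, (pinnedChain ω₂ lam β γ).bondCurrent N i x ∂(μ N (T + δ / 2) (T - δ / 2)) = 0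
          exact Finset.sum_eq_zero fun i _ => by simp only [hj, integral_zero]
        rw [this, zero_div]
    rw [e]
    exact tendsto_const_nhds
  · -- `N ≥ 2`: the open-chain Green–Kubo identity
    obtain ⟨-, h2⟩ := OddSectorIrreversibility.Corrector.openChainGreenKubo_holds ω₂ lam β γ hω hl hβ hγ hU μ hμ T hT N hN
    exact ⟨_, h2⟩

/-- **`OddSectorIrreversibility.FiniteResponseOfUnique` holds** (route OddSectorIrreversibility, crux rank 9).
[cite: KunduDharNarayan2009, p. 3] -/
theorem finiteResponseOfUnique_holds :
    Summit.AtomisticToContinuum.FouriersLaw.Theses.OddSectorIrreversibility.FiniteResponseOfUnique :=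
  finiteResponse_of_unique

/-- **`FourierGreenKubo.FourierFiniteResponseOfUnique` holds** (route FourierGreenKubo).
[cite: KunduDharNarayan2009, p. 3] -/
theorem fourierFiniteResponseOfUnique_holds :
    Summit.AtomisticToContinuum.FouriersLaw.Theses.FourierGreenKubo.FourierFiniteResponseOfUnique :=
  finiteResponse_of_unique

/-- **`FeketeResistance.FiniteResponseOfUnique` holds** (route FeketeResistance).
[cite: KunduDharNarayan2009, p. 3] -/
theorem feketeFiniteResponseOfUnique_holds :
    Summit.AtomisticToContinuum.FouriersLaw.Theses.FeketeResistance.FiniteResponseOfUnique :=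
  finiteResponse_of_unique

/-- **`SuperadditiveJunction.FiniteResponseOfUnique` holds** (route SuperadditiveJunction).
[cite: KunduDharNarayan2009, p. 3] -/
theorem superadditiveFiniteResponseOfUnique_holds :
    Summit.AtomisticToContinuum.FouriersLaw.Theses.SuperadditiveJunction.FiniteResponseOfUnique :=
  finiteResponse_of_unique

end Summit.AtomisticToContinuum.FouriersLaw.Theorems.FourierGreenKubo

end
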